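import Mathlib.NumberTheory.Fermat
import Mathlib.Data.Nat.Factorization.Basic
import Mathlib.Tactic.NormNum.Prime
import HarnessLib

/-!
# Crocker 1971: `2^(2^n) − 1` is not a prime plus two distinct powers of two (Lemma I), and the
# 28-congruence covering system behind his Theorem I, checked modulo `720`

Topic `Literature/NumberTheory/Sieve` (primes plus powers of two; companion of
`PrimePlusPowTwoFreeProgressions.lean` — Erdős's / Chen–Dai–Li's progressions free of `p + 2^k` — and
of the Goldbach–Linnik files).  **NOT a route to Goldbach; nothing here is new mathematics.**  This is the
negative side, for ODD numbers and TWO powers, of the question Gallagher (Invent. Math. 29 (1975), p. 141,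
problem (a)) left open — "is each large odd integer the sum of a prime and a bounded number of powers of 2?"
— read from the primary and checked by the kernel (harness cell `pub-lg7`, COMPARATORS §26 F123 / §27).

R. Crocker, *On the sum of a prime and of two powers of two*, Pacific J. Math. 36 (1971) 103–107
(open access, MSP; page images read):

* **Lemma I** (p. 104, verbatim): "For every `n ≥ 3`, `2^{2^n} − 1` cannot be expressed as the sum of a
  prime and of two distinct positive powers of 2."  Proof (ibid., complete): "Taking `a > b` …, consider
  `2^{2^n} − 1 − 2^a − 2^b = 2^{2^n} − 1 − 2^b(2^{a−b} + 1)` where `a, b < 2^n`.  Since `a − b < 2^n`, it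
  follows that for each `a − b`, `2^{2^r} + 1 ∣ 2^{2^n} − 1 − 2^b(2^{a−b} + 1)` for some `r < n` (`r` being
  the largest power of 2 contained in `a − b`).  But since `2^{2^n} − 1 − 2^{2^n−1} − 2^{2^n−2} =
  2^{2^n−2} − 1 > 2^{2^{n−1}} + 1` for `n ≥ 3`, it follows that `2^{2^n} − 1 − 2^a − 2^b > 2^{2^r} + 1`.
  The lemma follows."  (Footnote 1: communicated by Schinzel; also in Sierpiński, *Elementary Theory of
  Numbers* (1964), p. 413.)  PROVED below as `crocker1971_lemma1`, for all `a ≠ b` (positivity of the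
  exponents is not needed by the argument), with the Fermat numbers `Nat.fermatNumber r = 2^{2^r} + 1` of
  Mathlib (`Nat.prod_fermatNumber` gives `F_r ∣ 2^{2^n} − 1` for `r < n`; `x + 1 ∣ x^m + 1` for odd `m`
  gives `F_r ∣ 2^{a−b} + 1`).
* **Theorem I** (p. 103): "There is an infinity of distinct, positive odd integers not representable as
  the sum of a prime and of two positive powers of 2."  Its proof (pp. 103–107) combines Lemma II (a
  generalisation of Lemma I) with an "overlapping congruence system" (1) and a Chinese-remainder
  construction; **Theorem I is formalised in §5 (appended 2026-08-19)**; §2 checks the two COMPUTATIONAL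
  sentences of that proof: p. 106, verbatim, "(1) to be `0 (mod 3), 0 (mod 5), 1 (mod 9), 1 (mod 10), 8 (mod 12),
  8 (mod 15), 4 (mod 18), 7 (mod 20), 5 (mod 24), 29 (mod 30), 2 (mod 36), 14 (mod 36), 17 (mod 40),
  34 (mod 45), 43 (mod 45), 13 (mod 48), 37 (mod 48), 16 (mod 60), 19 (mod 60), 26 (mod 72), 62 (mod 72),
  52 (mod 90), 37 (mod 120), 49 (mod 144), 121 (mod 144), 103 (mod 180), 106 (mod 180), 229 (mod 360)`.
  (1) can be shown to be an overlapping congruence system by a very straightforward (though lengthy)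
  numerical method — namely by writing all these congruences (mod 720), 720 being the L.C.M. of the
  `m_i`'s chosen here, and then checking that one obtains a complete residue system mod 720"
  (`crockerSystem_covers_720`, `decide +kernel`; `crockerSystem_covers`), and p. 107 "since `m_i = 2^{β_i}k′`
  where `k′` is odd and `> 1` …, `m_i ∤ 2^n`" (`crockerSystem_moduli_not_dvd_two_pow`: every modulus is
  divisible by `3` or `5`).  The system has `28` congruences (`h = 28` on p. 107) and `∑ 1/m_i = 27/20`.

* §4 (appended 2026-08-19): **Lemma II** (p. 104: "For `n ≥ 3` and `w ≡ 1 (mod 16)`, consider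
  `w ∏_{i=0}^{n−1} B_i ≤ 2^{2^n} − 1`, where `B_i ∣ 2^{2^i} + 1` and `B_i > 1` (though not necessarily prime or
  `< 2^{2^i} + 1`). Then `w ∏ B_i` cannot be expressed as the sum of a prime and of two positive distinct powers
  of 2") PROVED as `crocker1971_lemma2`, following the printed proof (divisors of `F_i` are `≡ 1 (mod 2^{i+1})`,
  `mod_eq_one_of_dvd_fermatNumber`, from Mathlib's `Nat.pow_pow_add_primeFactors_one_lt`; `F_0, …, F_4` prime;
  the residues mod `16`).
* §5 (appended 2026-08-19): **Theorem I PROVED** (`crocker1971_theorem1`: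
  `Set.Infinite {t | t % 2 = 1 ∧ ∀ p a b, p.Prime → 0 < a → 0 < b → t ≠ p + 2^a + 2^b}`) by the printed
  assembly with explicit data: system (2) with moduli `q_i`, `2^{m_i} ≡ 1 (mod q_i)` (p. 107's primes of the
  right orders; their primality is not needed), `c = 0` modulo `2^{13} − 1`, `G_10 = F_10/45592577`, the fixed
  modulus `D = 16·8191·∏ q_i ≤ G_10` with its residue `R` checked congruence by congruence, the Chinese
  remainder theorem (Mathlib's `Nat.chineseRemainder`) for `t_n ≡ R (mod D)`, `t_n ≡ 0 (mod P_n)`,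
  `P_n = 45592577·∏_{i<n, i≠10} F_i`, `n ≥ 11`; then (1)–(2) exclude `p + 2^k`, Lemma II excludes
  `p + 2^a + 2^b` (`a ≠ b`), and `t_{n+1} ≥ F_n > t_n`.
* §3 (appended 2026-08-19): the counting lemma that a finite system of residue classes covering `ℕ` has
  `∑ 1/m_i ≥ 1` (`one_le_sum_inv_of_covering`; count modulo `∏ m_i`), instanced on Crocker's system
  (`crockerSystem_density_ge_one`); it is the pre-filter of the cell's numerical reproduction of
  Chen–Dai–Li 2025, Thm 2 (a progression free of `p + 2^k` needs primes `q` with `∑ 1/ord_q 2 ≥ 1`).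

No `sorry`; no named facts; the only definition is the finite datum `crockerSystem`.

## References

* R. Crocker, Pacific J. Math. 36 (1971) 103–107, doi:10.2140/pjm.1971.36.103: Lemma I (p. 104) with its
  proof; the system (1) (p. 106); p. 107. [Crocker1971]
* P. X. Gallagher, *Primes and powers of 2*, Invent. Math. 29 (1975) 125–142, p. 141 problem (a).
  [Gallagher1975]
* A. Granville, K. Soundararajan, Ramanujan J. 2 (1998) 283–298, § "Covering systems and all that"
  ("Crocker [2] observed that for any odd integer `n = 2^{2^m} − 1` with `m ≥ 3`, the numbers
  `n − 2^a − 2^b` with `1 ≤ a < b < 2^m` are never prime"). [GranvilleSoundararajan1998]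
-/

namespace Literature.NumberTheory.Sieve

namespace Crocker1971

open Nat Finset

/-! ### §1 Lemma I: `2^(2^n) − 1 ≠ p + 2^a + 2^b` (`a ≠ b`, `n ≥ 3`) -/

/-- `F_r = 2^{2^r} + 1` divides `2^{2^r·m} + 1` for odd `m` (`x + 1 ∣ x^m + 1`).
[cite: Crocker1971, proof of Lemma I, p. 104] -/
theorem fermatNumber_dvd_two_pow_add_one {r m : ℕ} (hm : Odd m) :
    fermatNumber r ∣ 2 ^ (2 ^ r * m) + 1 := by
  have h := Odd.nat_add_dvd_pow_add_pow (2 ^ (2 ^ r)) 1 hm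
  rwa [one_pow, ← pow_mul] at h

/-- `F_r ∣ 2^{2^n} − 1` for `r < n` (`2^{2^n} − 1 = ∏_{k<n} F_k`, Mathlib's `Nat.prod_fermatNumber`).
[cite: Crocker1971, proof of Lemma I, p. 104] -/
theorem fermatNumber_dvd_two_pow_two_pow_sub_one {r n : ℕ} (h : r < n) :
    fermatNumber r ∣ 2 ^ (2 ^ n) - 1 := by
  have h1 : fermatNumber r ∣ ∏ k ∈ range n, fermatNumber k := dvd_prod_of_mem _ (mem_range.mpr h)
  rw [prod_fermatNumber] at h1
  have h2 : fermatNumber n - 2 = 2 ^ (2 ^ n) - 1 := by unfold fermatNumber; omega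
  rwa [h2] at h1

/-- The case `b < a` of Lemma I. [cite: Crocker1971, Lemma I and proof, p. 104] -/
theorem lemma1_of_lt {n : ℕ} (hn : 3 ≤ n) {p a b : ℕ} (hp : p.Prime) (hba : b < a)
    (h : 2 ^ (2 ^ n) - 1 = p + 2 ^ a + 2 ^ b) : False := by
  -- notation: `N = 2^n ≥ 8`
  have hN8 : 8 ≤ 2 ^ n := by
    calc (8 : ℕ) = 2 ^ 3 := by norm_num
      _ ≤ 2 ^ n := Nat.pow_le_pow_right (by norm_num) hn
  -- `a < N`
  have hpos_a : 0 < 2 ^ a := Nat.two_pow_pos a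
  have hpos_b : 0 < 2 ^ b := Nat.two_pow_pos b
  have hpos_N : 0 < 2 ^ (2 ^ n) := Nat.two_pow_pos _
  have haN : a < 2 ^ n := by
    have h1 : 2 ^ a < 2 ^ (2 ^ n) := by omega
    exact (Nat.pow_lt_pow_iff_right (by norm_num)).mp h1
  -- `d = a - b = 2^r · m`, `m` odd, `r < n`
  obtain ⟨r, m, hm, hd⟩ := exists_eq_two_pow_mul_odd (show a - b ≠ 0 by omega)
  have hm1 : 1 ≤ m := by obtain ⟨j, rfl⟩ := hm; omega
  have hrn : r < n := by
    have h1 : 2 ^ r ≤ a - b := by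
      calc 2 ^ r = 2 ^ r * 1 := (mul_one _).symm
        _ ≤ 2 ^ r * m := Nat.mul_le_mul_left _ hm1
        _ = a - b := hd.symm
    have h2 : 2 ^ r < 2 ^ n := by omega
    exact (Nat.pow_lt_pow_iff_right (by norm_num)).mp h2
  -- `F_r ∣ 2^(2^n) - 1` and `F_r ∣ 2^a + 2^b = 2^b (2^(a-b) + 1)`
  have hF1 : fermatNumber r ∣ 2 ^ (2 ^ n) - 1 := fermatNumber_dvd_two_pow_two_pow_sub_one hrn
  have hF2 : fermatNumber r ∣ 2 ^ a + 2 ^ b := by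
    have e : 2 ^ a + 2 ^ b = 2 ^ b * (2 ^ (2 ^ r * m) + 1) := by
      rw [← hd, mul_add, mul_one, ← pow_add, Nat.add_sub_cancel' hba.le]
    rw [e]
    exact Dvd.dvd.mul_left (fermatNumber_dvd_two_pow_add_one hm) _
  -- hence `F_r ∣ p`
  have hFp : fermatNumber r ∣ p := by
    have h3 : fermatNumber r ∣ (2 ^ a + 2 ^ b) + p := by
      rw [h] at hF1
      have e : p + 2 ^ a + 2 ^ b = (2 ^ a + 2 ^ b) + p := by ring
      rwa [e] at hF1
    exact (Nat.dvd_add_right hF2).mp h3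
  -- so `F_r = p`
  have hFeq : fermatNumber r = p := by
    rcases (Nat.dvd_prime hp).mp hFp with h1 | h1
    · exact absurd h1 (fermatNumber_ne_one r)
    · exact h1
  -- size: `F_r = 2^(2^r) + 1 ≤ 2^(N-3) + 1 < 2^(N-2) - 1 ≤ p`
  have ht2 : 2 * 2 ^ r ≤ 2 ^ n := by
    calc 2 * 2 ^ r = 2 ^ (r + 1) := by ring
      _ ≤ 2 ^ n := Nat.pow_le_pow_right (by norm_num) hrn
  have htN : 2 ^ r ≤ 2 ^ n - 3 := by omega
  have hT : 2 ^ (2 ^ r) ≤ 2 ^ (2 ^ n - 3) := Nat.pow_le_pow_right (by norm_num) htN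
  have eN : 2 ^ (2 ^ n) = 2 ^ (2 ^ n - 3) * 8 := by
    rw [show (8 : ℕ) = 2 ^ 3 by norm_num, ← pow_add, Nat.sub_add_cancel (by omega)]
  have hA : 2 ^ a ≤ 2 ^ (2 ^ n - 3) * 4 := by
    calc 2 ^ a ≤ 2 ^ (2 ^ n - 1) := Nat.pow_le_pow_right (by norm_num) (by omega)
      _ = 2 ^ (2 ^ n - 3) * 4 := by
          rw [show (4 : ℕ) = 2 ^ 2 by norm_num, ← pow_add]; congr 1; omega
  have hB : 2 ^ b ≤ 2 ^ (2 ^ n - 3) * 2 := by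
    calc 2 ^ b ≤ 2 ^ (2 ^ n - 2) := Nat.pow_le_pow_right (by norm_num) (by omega)
      _ = 2 ^ (2 ^ n - 3) * 2 := by
          rw [← pow_succ]; congr 1; omega
  have hX : 4 ≤ 2 ^ (2 ^ n - 3) := by
    calc (4 : ℕ) = 2 ^ 2 := by norm_num
      _ ≤ 2 ^ (2 ^ n - 3) := Nat.pow_le_pow_right (by norm_num) (by omega)
  have hFr : fermatNumber r = 2 ^ (2 ^ r) + 1 := rfl
  omega

/-- **Crocker 1971, Lemma I** (Schinzel; Sierpiński p. 413): for every `n ≥ 3`, `2^{2^n} − 1` is not the sum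
of a prime and of two DISTINCT powers of `2` — here for all exponents `a ≠ b` (the printed "positive" is
not needed).  [cite: Crocker1971, Lemma I (p. 104) and its proof]
[cite: GranvilleSoundararajan1998, § "Covering systems and all that" (Crocker's observation)] -/
theorem crocker1971_lemma1 {n : ℕ} (hn : 3 ≤ n) {p a b : ℕ} (hp : p.Prime) (hab : a ≠ b) :
    2 ^ (2 ^ n) - 1 ≠ p + 2 ^ a + 2 ^ b := by
  intro h
  rcases Nat.lt_or_gt_of_ne hab with hlt | hlt
  · exact lemma1_of_lt hn hp hlt (by rw [h]; ring)
  · exact lemma1_of_lt hn hp hlt h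

/-- The smallest instance, `n = 3`: `255 = 2^8 − 1` is not `p + 2^a + 2^b` with `a ≠ b`.
[cite: Crocker1971, Lemma I, p. 104] -/
theorem not_255_eq_prime_add_two_distinct_pow {p a b : ℕ} (hp : p.Prime) (hab : a ≠ b) :
    255 ≠ p + 2 ^ a + 2 ^ b := by
  have h := crocker1971_lemma1 (n := 3) le_rfl hp hab
  norm_num at h
  exact h

/-! ### §2 The overlapping congruence system (1) of the proof of Theorem I, checked modulo `720` -/

/-- Crocker's system (1): the 28 pairs `(a_i, m_i)` as printed on p. 106. [cite: Crocker1971, p. 106, display (1)] -/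
def crockerSystem : List (ℕ × ℕ) :=
  [(0, 3), (0, 5), (1, 9), (1, 10), (8, 12), (8, 15), (4, 18), (7, 20), (5, 24), (29, 30), (2, 36), (14, 36),
   (17, 40), (34, 45), (43, 45), (13, 48), (37, 48), (16, 60), (19, 60), (26, 72), (62, 72), (52, 90),
   (37, 120), (49, 144), (121, 144), (103, 180), (106, 180), (229, 360)]

/-- `h = 28` congruences. [cite: Crocker1971, p. 107 ("at most 28 (= h) distinct residues")] -/
theorem crockerSystem_length : crockerSystem.length = 28 := rfl

/-- Every modulus divides `720` ("720 being the L.C.M. of the `m_i`'s"), and every residue is reduced.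
[cite: Crocker1971, p. 106] -/
theorem crockerSystem_moduli_dvd_720 : ∀ am ∈ crockerSystem, am.2 ∣ 720 ∧ am.1 < am.2 := by
  decide

/-- **The numerical check of p. 106**: the 28 congruences cover a complete residue system mod `720`.
[cite: Crocker1971, p. 106 ("(1) can be shown to be an overlapping congruence system … mod 720")] -/
theorem crockerSystem_covers_720 : ∀ x < 720, ∃ am ∈ crockerSystem, x % am.2 = am.1 := by
  decide +kernel

/-- Hence system (1) is an "overlapping congruence system": every natural number satisfies one of the 28
congruences. [cite: Crocker1971, p. 106] -/
theorem crockerSystem_covers (x : ℕ) : ∃ am ∈ crockerSystem, x % am.2 = am.1 := by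
  obtain ⟨am, ham, h⟩ := crockerSystem_covers_720 (x % 720) (Nat.mod_lt _ (by norm_num))
  exact ⟨am, ham, by rw [← Nat.mod_mod_of_dvd x (crockerSystem_moduli_dvd_720 am ham).1, h]⟩

/-- Every modulus `m_i` is divisible by `3` or by `5` (its odd part `k′` is `> 1`). [cite: Crocker1971, p. 107] -/
theorem crockerSystem_moduli_odd_part : ∀ am ∈ crockerSystem, 3 ∣ am.2 ∨ 5 ∣ am.2 := by
  decide

/-- … so no modulus divides a power of `2` ("`m_i ∤ 2^n`", p. 107 — the point of avoiding the moduli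
`2, 4, 8, …` which Erdős's system uses). [cite: Crocker1971, p. 107] -/
theorem crockerSystem_moduli_not_dvd_two_pow : ∀ am ∈ crockerSystem, ∀ j : ℕ, ¬ am.2 ∣ 2 ^ j := by
  intro am ham j hdvd
  rcases crockerSystem_moduli_odd_part am ham with h3 | h5
  · have h : 3 ∣ 2 ^ j := dvd_trans h3 hdvd
    have := (Nat.Prime.dvd_of_dvd_pow Nat.prime_three h)
    omega
  · have h : 5 ∣ 2 ^ j := dvd_trans h5 hdvd
    have := (Nat.Prime.dvd_of_dvd_pow Nat.prime_five h)
    omega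

/-- The density bookkeeping of the system: `∑ 1/m_i = 27/20` (so the 28 classes overlap; `720·27/20 = 972`
residues counted with multiplicity for `720` classes). [cite: Crocker1971, p. 106] -/
theorem crockerSystem_sum_inv_moduli :
    ((crockerSystem.map fun am => ((am.2 : ℚ))⁻¹).sum) = 27 / 20 := by
  simp only [crockerSystem, List.map_cons, List.map_nil, List.sum_cons, List.sum_nil]
  norm_num

/-! ### §3 The density of a covering system is at least `1` (appended 2026-08-19)

The counting remark behind every search for such systems ("∑ 1/d_i > 1 … implying that a CDL covering system must
satisfy D ≥ 12", Chen–Dai–Li 2025 §2.3; Crocker's `27/20`, Erdős's `1/2+1/3+1/4+1/8+1/12+1/24 = 4/3`): modulo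
`L = ∏ m_i` the class `a (mod m)` has at most `L/m` members in `[0, L)`.  Used by the cell as the pre-filter of its
numerical reproduction of Chen–Dai–Li's Theorem 2 (only moduli whose odd prime divisors `q` have
`∑ 1/ord_q 2 ≥ 1` can carry a progression free of `p + 2^k`). -/

/-- In `[0, L)` a residue class `r (mod m)` with `m ∣ L` has at most `L/m` members. [folklore] -/
theorem card_range_filter_mod_le {L m r : ℕ} (hmL : m ∣ L) :
    ((Finset.range L).filter (fun x => x % m = r)).card ≤ L / m := by
  have h : ((Finset.range L).filter (fun x => x % m = r)).card ≤ (Finset.range (L / m)).card := by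
    refine Finset.card_le_card_of_injOn (fun x => x / m) (fun x hx => ?_) (fun x hx y hy hxy => ?_)
    · rw [Finset.mem_coe, Finset.mem_filter, Finset.mem_range] at hx
      rw [Finset.mem_coe, Finset.mem_range]
      exact Nat.div_lt_div_of_lt_of_dvd hmL hx.1
    · rw [Finset.mem_coe, Finset.mem_filter] at hx hy
      have ex := Nat.div_add_mod x m
      have ey := Nat.div_add_mod y m
      have : x / m = y / m := hxy
      rw [← ex, ← ey, this, hx.2, hy.2]
  rwa [Finset.card_range] at h

/-- **A finite system of residue classes covering `ℕ` has density sum `∑ 1/m_i ≥ 1`** (count modulo `L = ∏ m_i`).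
[cite: ChenDaiLi2025, §2.3 ("we observe that ∑ 1/d_i > 2 [for CDL systems]; … ∑ 1/d_i > 1")]
[cite: Crocker1971, p. 106 (the 28 classes: 27/20)] -/
theorem one_le_sum_inv_of_covering {ι : Type*} (s : Finset ι) (a m : ι → ℕ) (hm : ∀ i ∈ s, 0 < m i)
    (hcov : ∀ x : ℕ, ∃ i ∈ s, x % m i = a i % m i) : (1 : ℚ) ≤ ∑ i ∈ s, ((m i : ℚ))⁻¹ := by
  classical
  obtain ⟨L, hLdef⟩ : ∃ L : ℕ, L = ∏ i ∈ s, m i := ⟨_, rfl⟩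
  have hL : 0 < L := by rw [hLdef]; exact Finset.prod_pos hm
  have hdvd : ∀ i ∈ s, m i ∣ L := fun i hi => by rw [hLdef]; exact Finset.dvd_prod_of_mem m hi
  have hsub : Finset.range L ⊆
      s.biUnion (fun i => (Finset.range L).filter (fun x => x % m i = a i % m i)) := by
    intro x hx
    obtain ⟨i, hi, h⟩ := hcov x
    exact Finset.mem_biUnion.mpr ⟨i, hi, Finset.mem_filter.mpr ⟨hx, h⟩⟩
  have h1 : L ≤ ∑ i ∈ s, L / m i := by
    calc L = (Finset.range L).card := (Finset.card_range L).symm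
      _ ≤ (s.biUnion (fun i => (Finset.range L).filter (fun x => x % m i = a i % m i))).card :=
          Finset.card_le_card hsub
      _ ≤ ∑ i ∈ s, ((Finset.range L).filter (fun x => x % m i = a i % m i)).card := Finset.card_biUnion_le
      _ ≤ ∑ i ∈ s, L / m i := Finset.sum_le_sum (fun i hi => card_range_filter_mod_le (hdvd i hi))
  have h2 : (L : ℚ) ≤ ∑ i ∈ s, ((L / m i : ℕ) : ℚ) := by exact_mod_cast h1
  have h3 : ∀ i ∈ s, ((L / m i : ℕ) : ℚ) = (L : ℚ) * ((m i : ℚ))⁻¹ := fun i hi => by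
    rw [Nat.cast_div (hdvd i hi) (by exact_mod_cast (hm i hi).ne'), div_eq_mul_inv]
  rw [Finset.sum_congr rfl h3, ← Finset.mul_sum] at h2
  have hLq : (0 : ℚ) < L := by exact_mod_cast hL
  by_contra hlt
  rw [not_le] at hlt
  have : (L : ℚ) * ∑ i ∈ s, ((m i : ℚ))⁻¹ < (L : ℚ) * 1 := mul_lt_mul_of_pos_left hlt hLq
  linarith

/-- Crocker's 28 classes do cover `ℕ` and their density sum `27/20` is indeed `≥ 1` — an instance of the lemma.
[cite: Crocker1971, p. 106] -/
theorem crockerSystem_density_ge_one :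
    (1 : ℚ) ≤ ∑ am ∈ crockerSystem.toFinset, ((am.2 : ℚ))⁻¹ := by
  refine one_le_sum_inv_of_covering crockerSystem.toFinset (fun am => am.1) (fun am => am.2) ?_ ?_
  · intro am ham
    exact Nat.lt_of_lt_of_le (Nat.zero_lt_of_lt (crockerSystem_moduli_dvd_720 am (List.mem_toFinset.mp ham)).2)
      le_rfl
  · intro x
    obtain ⟨am, ham, h⟩ := crockerSystem_covers x
    refine ⟨am, List.mem_toFinset.mpr ham, ?_⟩
    rw [h, Nat.mod_eq_of_lt (crockerSystem_moduli_dvd_720 am ham).2]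

/-! ### §4 Lemma II: `w · ∏_{i<n} B_i` (`B_i ∣ F_i`, `B_i > 1`, `w ≡ 1 (mod 16)`, `≤ 2^{2^n} − 1`) is not a
prime plus two distinct positive powers of two (appended 2026-08-19)

[Crocker1971, Lemma II, p. 104], verbatim: "For `n ≥ 3` and `w ≡ 1 (mod 16)`, consider `w ∏_{i=0}^{n−1} B_i ≤
2^{2^n} − 1`, where `B_i ∣ 2^{2^i} + 1` and `B_i > 1` (though not necessarily prime or `< 2^{2^i} + 1`).  Then
`w ∏_{i=0}^{n−1} B_i (≤ 2^{2^n} − 1)` cannot be expressed as the sum of a prime and of two positive distinct powers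
of 2."  Proof as printed (pp. 104–105): for `n = 3, 4, 5` Lemma I applies (`F_0, …, F_4` are prime, so
`B_i = F_i` and `w = 1`); for `n ≥ 6`, with `a > b`, `B_r ∣ w∏B_i − 2^b(2^{a−b} + 1)` for `r = ν_2(a − b) < n`, so
the prime would be `B_r`; but `w∏B_i ≡ −1 (mod 16)` (`B_i ≡ 1 (mod 2^{i+1})`, `∏_{i<5} F_i = 2^{32} − 1`), `2^a ≡ 0`,
`2^b ≡ 0, 2, 4, 8`, `B_r ≡ 1, 3, 5 (mod 16)` — impossible.  (Here positivity of `b` IS used.) -/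

/-- Every divisor of the Fermat number `F_i` is `≡ 1 (mod 2^{i+1})` (prime divisors by the order of `2`, Mathlib's
`Nat.pow_pow_add_primeFactors_one_lt`; in general by induction over the factorisation).
[cite: Crocker1971, proof of Lemma II, p. 105 ("B_i ≡ 1 (mod 2^{i+1})")] -/
theorem mod_eq_one_of_dvd_fermatNumber {i : ℕ} : ∀ {d : ℕ}, d ∣ fermatNumber i → d % 2 ^ (i + 1) = 1 := by
  intro d
  induction d using Nat.strong_induction_on with
  | _ d ih =>
    intro hd
    have hM : 1 < 2 ^ (i + 1) := Nat.one_lt_two_pow (by omega)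
    rcases Nat.lt_or_ge d 2 with hd2 | hd2
    · interval_cases d
      · exact absurd (zero_dvd_iff.mp hd) (by have := three_le_fermatNumber i; omega)
      · exact Nat.mod_eq_of_lt hM
    · -- `q = minFac d` is an odd prime divisor of `F_i`
      have hq : (Nat.minFac d).Prime := Nat.minFac_prime (by omega)
      have hqd : Nat.minFac d ∣ d := Nat.minFac_dvd d
      have hqF : Nat.minFac d ∣ 2 ^ (2 ^ i) + 1 := dvd_trans hqd hd
      have hq2 : Nat.minFac d ≠ 2 := by
        intro h2
        have : 2 ∣ fermatNumber i := by rw [← h2]; exact dvd_trans hqd hd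
        exact (Nat.not_even_iff_odd.mpr (odd_fermatNumber i)) (even_iff_two_dvd.mpr this)
      obtain ⟨k, hk⟩ := Nat.pow_pow_add_primeFactors_one_lt hq hq2 hqF
      -- `d = q · (d / q)` with `d / q < d` a divisor of `F_i`
      have hdq : d = Nat.minFac d * (d / Nat.minFac d) := (Nat.mul_div_cancel' hqd).symm
      have hlt : d / Nat.minFac d < d := Nat.div_lt_self (by omega) hq.one_lt
      have hdvd' : d / Nat.minFac d ∣ fermatNumber i := dvd_trans (Nat.div_dvd_of_dvd hqd) hd
      have ih' := ih _ hlt hdvd'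
      have hqmod : Nat.minFac d % 2 ^ (i + 1) = 1 := by
        rw [hk, Nat.mul_add_mod_self_right]  -- hmm: k * 2^(i+1) + 1
        exact Nat.mod_eq_of_lt hM
      rw [hdq, Nat.mul_mod, hqmod, ih', one_mul]
      exact Nat.mod_eq_of_lt hM

/-- In particular a divisor of `F_i`, `i ≥ 3`, is `≡ 1 (mod 16)`. [cite: Crocker1971, proof of Lemma II, p. 105] -/
theorem mod_sixteen_of_dvd_fermatNumber {i d : ℕ} (hi : 3 ≤ i) (hd : d ∣ fermatNumber i) : d % 16 = 1 := by
  have h := mod_eq_one_of_dvd_fermatNumber hd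
  have h16 : 16 ∣ 2 ^ (i + 1) := by
    rw [show (16 : ℕ) = 2 ^ 4 by norm_num]
    exact Nat.pow_dvd_pow 2 (by omega)
  rw [← Nat.mod_mod_of_dvd d h16, h]

/-- The first five Fermat numbers are prime, so a divisor `> 1` of `F_i`, `i < 5`, is `F_i` itself.
[cite: Crocker1971, proof of Lemma II, p. 104 ("If n = 3, 4 or 5, Lemma I is immediately applicable")] -/
theorem eq_fermatNumber_of_dvd_of_lt_five {i d : ℕ} (hi : i < 5) (hd : d ∣ fermatNumber i) (h1 : 1 < d) :
    d = fermatNumber i := by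
  have hF : (fermatNumber i).Prime := by
    interval_cases i
    · exact fermatNumber_zero ▸ Nat.prime_three
    · exact fermatNumber_one ▸ Nat.prime_five
    · rw [fermatNumber_two]; norm_num
    · rw [show fermatNumber 3 = 257 by norm_num [fermatNumber]]; norm_num
    · rw [show fermatNumber 4 = 65537 by norm_num [fermatNumber]]; norm_num
  rcases (Nat.dvd_prime hF).mp hd with h | h
  · omega
  · exact h

/-- `∏_{i<5} F_i = 2^{32} − 1 ≡ 15 (mod 16)`, and for `n ≥ 5` a product `∏_{i<n} B_i` with `1 < B_i ∣ F_i` is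
`≡ 15 (mod 16)`. [cite: Crocker1971, proof of Lemma II, p. 105 ("∏ B_i ≡ −1 (mod 16)")] -/
theorem prod_mod_sixteen {n : ℕ} (hn : 5 ≤ n) (B : ℕ → ℕ) (hB : ∀ i < n, B i ∣ fermatNumber i ∧ 1 < B i) :
    (∏ i ∈ range n, B i) % 16 = 15 := by
  rw [← prod_range_mul_prod_Ico B hn]
  have h5 : ∏ i ∈ range 5, B i = 3 * 5 * 17 * 257 * 65537 := by
    have e : ∀ i < 5, B i = fermatNumber i := fun i hi =>
      eq_fermatNumber_of_dvd_of_lt_five hi (hB i (by omega)).1 (hB i (by omega)).2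
    simp only [prod_range_succ, prod_range_zero, one_mul, e 0 (by norm_num), e 1 (by norm_num),
      e 2 (by norm_num), e 3 (by norm_num), e 4 (by norm_num)]
    norm_num [fermatNumber]
  have hrest : (∏ i ∈ Ico 5 n, B i) % 16 = 1 := by
    rw [prod_nat_mod]
    have : ∏ i ∈ Ico 5 n, B i % 16 = ∏ i ∈ Ico 5 n, 1 := by
      refine prod_congr rfl fun i hi => ?_
      rw [mem_Ico] at hi
      exact mod_sixteen_of_dvd_fermatNumber (by omega) (hB i hi.2).1
    rw [this, prod_const_one]
    norm_num
  rw [Nat.mul_mod, h5, hrest]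

/-- The case `b < a` of Lemma II for `n ≥ 6`. [cite: Crocker1971, Lemma II and proof, pp. 104–105] -/
theorem lemma2_of_lt {n : ℕ} (hn : 6 ≤ n) {w : ℕ} (hw : w % 16 = 1) (B : ℕ → ℕ)
    (hB : ∀ i < n, B i ∣ fermatNumber i ∧ 1 < B i) (hle : w * ∏ i ∈ range n, B i ≤ 2 ^ (2 ^ n) - 1)
    {p a b : ℕ} (hp : p.Prime) (hb : 0 < b) (hba : b < a)
    (h : w * ∏ i ∈ range n, B i = p + 2 ^ a + 2 ^ b) : False := by
  -- notation
  obtain ⟨N, hNdef⟩ : ∃ N, N = w * ∏ i ∈ range n, B i := ⟨_, rfl⟩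
  rw [← hNdef] at hle h
  have hpos_a : 0 < 2 ^ a := Nat.two_pow_pos a
  have hpos_b : 0 < 2 ^ b := Nat.two_pow_pos b
  have hpos_N2 : 0 < 2 ^ (2 ^ n) := Nat.two_pow_pos _
  -- `a < 2^n`
  have haN : a < 2 ^ n := by
    have h1 : 2 ^ a < 2 ^ (2 ^ n) := by omega
    exact (Nat.pow_lt_pow_iff_right (by norm_num)).mp h1
  -- `a - b = 2^r · m`, `m` odd, `r < n`
  obtain ⟨r, m, hm, hd⟩ := exists_eq_two_pow_mul_odd (show a - b ≠ 0 by omega)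
  have hm1 : 1 ≤ m := by obtain ⟨j, rfl⟩ := hm; omega
  have hrle : 2 ^ r ≤ a - b := by
    calc 2 ^ r = 2 ^ r * 1 := (mul_one _).symm
      _ ≤ 2 ^ r * m := Nat.mul_le_mul_left _ hm1
      _ = a - b := hd.symm
  have hrn : r < n := by
    have h2 : 2 ^ r < 2 ^ n := by omega
    exact (Nat.pow_lt_pow_iff_right (by norm_num)).mp h2
  -- `B_r ∣ N` and `B_r ∣ 2^a + 2^b`, hence `B_r ∣ p`, so `B_r = p`
  have hBr := hB r hrn
  have hBrN : B r ∣ N := by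
    rw [hNdef]; exact dvd_mul_of_dvd_right (dvd_prod_of_mem _ (mem_range.mpr hrn)) _
  have hBr2 : B r ∣ 2 ^ a + 2 ^ b := by
    have e : 2 ^ a + 2 ^ b = 2 ^ b * (2 ^ (2 ^ r * m) + 1) := by
      rw [← hd, mul_add, mul_one, ← pow_add, Nat.add_sub_cancel' hba.le]
    rw [e]
    exact Dvd.dvd.mul_left (dvd_trans hBr.1 (fermatNumber_dvd_two_pow_add_one hm)) _
  have hBrp : B r ∣ p := by
    have h3 : B r ∣ (2 ^ a + 2 ^ b) + p := by
      rw [h] at hBrN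
      have e : p + 2 ^ a + 2 ^ b = (2 ^ a + 2 ^ b) + p := by ring
      rwa [e] at hBrN
    exact (Nat.dvd_add_right hBr2).mp h3
  have hBeq : B r = p := by
    rcases (Nat.dvd_prime hp).mp hBrp with h1 | h1
    · exact absurd h1 (by have := hBr.2; omega)
    · exact h1
  -- `N ≡ 15 (mod 16)`
  have hN16 : N % 16 = 15 := by
    rw [hNdef, Nat.mul_mod, hw, prod_mod_sixteen (by omega) B hB]
  -- `a ≥ 4`: otherwise `r ≤ 1`, `B_r ≤ 5`, and `N ≤ 17`, while `N ≥ ∏ B_i ≥ 2^6`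
  have hNbig : 64 ≤ N := by
    have h1 : ∀ i ∈ range n, 2 ≤ B i := fun i hi => (hB i (mem_range.mp hi)).2
    have h2 : 2 ^ n ≤ ∏ i ∈ range n, B i := by
      calc 2 ^ n = ∏ _i ∈ range n, 2 := by rw [prod_const, card_range]
        _ ≤ ∏ i ∈ range n, B i := prod_le_prod' h1
    have h3 : 2 ^ 6 ≤ 2 ^ n := Nat.pow_le_pow_right (by norm_num) hn
    have hw1 : 1 ≤ w := by omega
    calc 64 = 2 ^ 6 := by norm_num
      _ ≤ ∏ i ∈ range n, B i := h3.trans h2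
      _ = 1 * ∏ i ∈ range n, B i := (one_mul _).symm
      _ ≤ w * ∏ i ∈ range n, B i := Nat.mul_le_mul_right _ hw1
      _ = N := hNdef.symm
  have ha4 : 4 ≤ a := by
    by_contra ha
    rw [not_le] at ha
    -- `a ≤ 3`, so `a - b ≤ 2`, so `2^r ≤ 2`, so `r ≤ 1`
    have hr1 : r ≤ 1 := by
      have : 2 ^ r < 2 ^ 2 := by omega
      have := (Nat.pow_lt_pow_iff_right (by norm_num : 1 < 2)).mp this
      omega
    -- `B_r ≤ 5`
    have hBr5 : B r ≤ 5 := by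
      have hF : fermatNumber r ≤ 5 := by
        interval_cases r <;> simp [fermatNumber]
      exact (Nat.le_of_dvd (by have := three_le_fermatNumber r; omega) hBr.1).trans hF
    -- `2^a + 2^b ≤ 12`
    have hab12 : 2 ^ a ≤ 8 ∧ 2 ^ b ≤ 4 := by
      constructor
      · calc 2 ^ a ≤ 2 ^ 3 := Nat.pow_le_pow_right (by norm_num) (by omega)
          _ = 8 := by norm_num
      · calc 2 ^ b ≤ 2 ^ 2 := Nat.pow_le_pow_right (by norm_num) (by omega)
          _ = 4 := by norm_num
    omega
  -- residues mod 16
  have ha16 : 2 ^ a % 16 = 0 := by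
    obtain ⟨c, rfl⟩ := Nat.exists_eq_add_of_le ha4
    rw [pow_add, show (2 : ℕ) ^ 4 = 16 by norm_num, Nat.mul_mod_right]
  have hb16 : 2 ^ b % 16 = 0 ∨ 2 ^ b % 16 = 2 ∨ 2 ^ b % 16 = 4 ∨ 2 ^ b % 16 = 8 := by
    rcases Nat.lt_or_ge b 4 with hb4 | hb4
    · interval_cases b <;> simp
    · left
      obtain ⟨c, rfl⟩ := Nat.exists_eq_add_of_le hb4
      rw [pow_add, show (2 : ℕ) ^ 4 = 16 by norm_num, Nat.mul_mod_right]
  have hBr16 : B r % 16 = 1 ∨ B r % 16 = 3 ∨ B r % 16 = 5 := by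
    rcases Nat.lt_or_ge r 3 with hr3 | hr3
    · have e := eq_fermatNumber_of_dvd_of_lt_five (by omega) hBr.1 hBr.2
      interval_cases r
      · rw [e, fermatNumber_zero]; simp
      · rw [e, fermatNumber_one]; simp
      · rw [e, fermatNumber_two]; simp
    · exact Or.inl (mod_sixteen_of_dvd_fermatNumber hr3 hBr.1)
  -- `N = B_r + 2^a + 2^b` contradicts the residues
  have hsum : N % 16 = (B r % 16 + 2 ^ a % 16 + 2 ^ b % 16) % 16 := by
    rw [h, ← hBeq]; simp [Nat.add_mod]
  rw [hN16, ha16] at hsum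
  rcases hb16 with hb' | hb' | hb' | hb' <;> rcases hBr16 with hB' | hB' | hB' <;>
    rw [hb', hB'] at hsum <;> norm_num at hsum

/-- **Crocker's Lemma II.**  For `n ≥ 3`, `w ≡ 1 (mod 16)` and `1 < B_i ∣ F_i` (`i < n`) with
`w · ∏_{i<n} B_i ≤ 2^{2^n} − 1`, the number `w · ∏_{i<n} B_i` is not `p + 2^a + 2^b` with `p` prime and `a ≠ b`
positive. [cite: Crocker1971, Lemma II, p. 104] -/
theorem crocker1971_lemma2 {n : ℕ} (hn : 3 ≤ n) {w : ℕ} (hw : w % 16 = 1) (B : ℕ → ℕ)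
    (hB : ∀ i < n, B i ∣ fermatNumber i ∧ 1 < B i) (hle : w * ∏ i ∈ range n, B i ≤ 2 ^ (2 ^ n) - 1)
    {p a b : ℕ} (hp : p.Prime) (ha : 0 < a) (hb : 0 < b) (hab : a ≠ b) :
    w * ∏ i ∈ range n, B i ≠ p + 2 ^ a + 2 ^ b := by
  rcases Nat.lt_or_ge n 6 with hn6 | hn6
  · -- `n = 3, 4, 5`: `B_i = F_i`, `∏ F_i = 2^{2^n} − 1`, `w = 1`, and Lemma I applies
    have e : ∀ i ∈ range n, B i = fermatNumber i := fun i hi =>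
      eq_fermatNumber_of_dvd_of_lt_five (by rw [mem_range] at hi; omega) (hB i (mem_range.mp hi)).1
        (hB i (mem_range.mp hi)).2
    have hprod : ∏ i ∈ range n, B i = 2 ^ (2 ^ n) - 1 := by
      rw [prod_congr rfl e, prod_fermatNumber]
      unfold fermatNumber
      omega
    rw [hprod] at hle ⊢
    have hpos : 0 < 2 ^ (2 ^ n) - 1 := by
      have : 2 ≤ 2 ^ (2 ^ n) := by
        calc (2 : ℕ) = 2 ^ 1 := by norm_num
          _ ≤ 2 ^ (2 ^ n) := Nat.pow_le_pow_right (by norm_num) (Nat.one_le_two_pow)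
      omega
    have hw1 : w = 1 := by
      have h1 : w ≤ 1 := by
        by_contra hw2
        rw [not_le] at hw2
        have : 2 * (2 ^ (2 ^ n) - 1) ≤ w * (2 ^ (2 ^ n) - 1) := Nat.mul_le_mul_right _ hw2
        omega
      omega
    rw [hw1, one_mul]
    exact crocker1971_lemma1 hn hp hab
  · intro h
    rcases Nat.lt_or_gt_of_ne hab with hlt | hlt
    · exact lemma2_of_lt hn6 hw B hB hle hp ha hlt (by rw [h]; ring)
    · exact lemma2_of_lt hn6 hw B hB hle hp hb hlt h

/-! ### §5 Theorem I (appended 2026-08-19): infinitely many odd integers are not `p + 2^a + 2^b`, `a, b ≥ 1`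

The assembly of [Crocker1971, pp. 103–107] with explicit data.  System (2): `t ≡ 2^{a_i} (mod q_i)` for the 28
congruences `a_i (mod m_i)` of (1), where `2^{m_i} ≡ 1 (mod q_i)` (we use, as the paper allows, moduli `q_i` with
`2` of order dividing `m_i`; primality of `q_i` is not needed by the argument once the residue `c` below avoids
`q_i + 2^d`), `t ≡ c (mod 2^{13} − 1)` with `c ≢ q_i + 2^d` (`0 ≤ d < 13`) — here `c = 0` —, `t ≡ −1 (mod 16)`;
and (3): `t ≡ 0 (mod (2^{2^n} − 1)/G_10)`, `G_10 = F_10/(2^{12}·11131 + 1) = F_10/45592577`, `t ≤ 2^{2^n} − 1`.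
The `q_i` (one for each congruence, two distinct ones for each repeated modulus; p. 107) are
`7, 31, 73, 11, 13, 151, 19, 41, 241, 331, 37, 109, 61681, 631, 23311, 97, 673, 61, 1321, 433, 38737, 18837001,
4562284561, 577, 487824887233, 181, 54001, 168692292721`; the fixed part of the modulus is
`D = 16 · 8191 · ∏ q_i` (a 104-digit number) with the fixed residue `R` (CRT, computed outside and CHECKED here
congruence by congruence), and `D ≤ G_10` replaces the printed "16 ∏ p_i < 2^{434} < 2^{998} < G_k" (p. 107).
For every `n ≥ 11` the Chinese remainder theorem gives `t_n ≡ R (mod D)`, `t_n ≡ 0 (mod P_n)`,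
`0 < t_n < D·P_n ≤ 2^{2^n} − 1`, `P_n = 45592577 · ∏_{i<n, i≠10} F_i`; by (1)–(2) `t_n` is not `p + 2^k`, by
Lemma II not `p + 2^a + 2^b` (`a ≠ b ≥ 1`), and `t_{n+1} ≥ F_n > t_n`, so these are infinitely many odd integers —
Theorem I (`crocker1971_theorem1`). -/

/-- System (2) data: triples `(a_i, m_i, q_i)` — the 28 congruences `a_i (mod m_i)` of (1) each with a modulus
`q_i > 1` such that `2^{m_i} ≡ 1 (mod q_i)`. [cite: Crocker1971, (2) p. 103 and p. 107] -/
def crockerData : List (ℕ × ℕ × ℕ) :=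
  [(0, 3, 7), (0, 5, 31), (1, 9, 73), (1, 10, 11), (8, 12, 13), (8, 15, 151), (4, 18, 19), (7, 20, 41), (5, 24, 241), (29, 30, 331), (2, 36, 37), (14, 36, 109), (17, 40, 61681), (34, 45, 631), (43, 45, 23311), (13, 48, 97), (37, 48, 673), (16, 60, 61), (19, 60, 1321), (26, 72, 433), (62, 72, 38737), (52, 90, 18837001), (37, 120, 4562284561), (49, 144, 577), (121, 144, 487824887233), (103, 180, 181), (106, 180, 54001), (229, 360, 168692292721)]

/-- The first two coordinates are the system (1). [cite: Crocker1971, (1) p. 106] -/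
theorem crockerData_map : crockerData.map (fun t => (t.1, t.2.1)) = crockerSystem := by decide

/-- The fixed residue `R (mod D)`: `R ≡ 15 (mod 16)`, `R ≡ 0 (mod 8191)`, `R ≡ 2^{a_i} (mod q_i)` (computed by the
Chinese remainder theorem outside the kernel; every congruence is checked below). [folklore] -/
def crockerR : ℕ :=
  20549659713846895339230826884746397449137971275347420864440736788647919650195378497605318334173164935935

/-- The fixed modulus `D = 16 · 8191 · ∏ q_i`. [cite: Crocker1971, p. 105 ("16 ∏ p_i")] -/
def crockerD : ℕ := (16 :: 8191 :: crockerData.map (fun t => t.2.2)).prod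

/-- All the finite checks of systems (1)–(2) at once: `2^{m_i} ≡ 1 (mod q_i)`, `q_i > 1`, `gcd(q_i, 2^{16} − 1) = 1`,
`m_i ∣ 720`, `a_i < m_i`, `R ≡ 2^{a_i} (mod q_i)`, and the condition on `c = 0`: `q_i + 2^d ≢ 0 (mod 8191)` for
`d < 13`. [cite: Crocker1971, p. 107] -/
theorem crockerData_facts : ∀ t ∈ crockerData,
    2 ^ t.2.1 % t.2.2 = 1 ∧ 1 < t.2.2 ∧ Nat.gcd t.2.2 65535 = 1 ∧ t.2.1 ∣ 720 ∧ t.1 < t.2.1 ∧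
      crockerR % t.2.2 = 2 ^ t.1 % t.2.2 ∧ ∀ d < 13, (t.2.2 + 2 ^ d) % 8191 ≠ 0 := by
  decide +kernel

/-- `R ≡ −1 (mod 16)`, `R ≡ 0 (mod 2^{13} − 1)`, `R < D`. [cite: Crocker1971, (2)–(3) pp. 103–105] -/
theorem crockerR_mod : crockerR % 16 = 15 ∧ crockerR % 8191 = 0 ∧ crockerR < crockerD := by
  decide +kernel

/-- `D > 0`. [cite: Crocker1971, p. 105] -/
theorem crockerD_pos : 0 < crockerD := by
  decide +kernel

/-- `G_10 = F_10 / (2^{12}·11131 + 1)`: `45592577 ∣ F_10`, and the size condition `D ≤ G_10` of p. 105/107.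
[cite: Crocker1971, p. 106 ("G_k = 2^{2^{10}} + 1 / 2^{12}·11131 + 1") and p. 107] -/
theorem crockerD_size : 45592577 ∣ 2 ^ (2 ^ 10) + 1 ∧ crockerD * 45592577 ≤ 2 ^ (2 ^ 10) + 1 := by
  decide +kernel

/-- System (1) covers, in the data form. [cite: Crocker1971, p. 106] -/
theorem crockerData_covers (k : ℕ) : ∃ t ∈ crockerData, k % t.2.1 = t.1 := by
  obtain ⟨am, ham, h⟩ := crockerSystem_covers k
  rw [← crockerData_map] at ham
  obtain ⟨t, ht, rfl⟩ := List.mem_map.mp ham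
  exact ⟨t, ht, h⟩

/-- `gcd(m, 2^n) ∣ 16` for `m ∣ 720` (the moduli of (1) have `2`-part at most `16`).
[cite: Crocker1971, p. 107 ("m_i = 2^{g_i} k′ where k′ is odd and > 1")] -/
theorem gcd_two_pow_dvd_sixteen {m : ℕ} (hm : m ∣ 720) (n : ℕ) : Nat.gcd m (2 ^ n) ∣ 16 := by
  have h1 : Nat.gcd m (2 ^ n) ∣ Nat.gcd 720 (2 ^ n) := Nat.gcd_dvd_gcd_of_dvd_left _ hm
  have h2 : Nat.gcd 720 (2 ^ n) = Nat.gcd 16 (2 ^ n) := by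
    rw [show (720 : ℕ) = 45 * 16 by norm_num]
    exact Nat.Coprime.gcd_mul_left_cancel 16 (Nat.Coprime.pow_right n (by norm_num : Nat.Coprime 45 2))
  rw [h2] at h1
  exact dvd_trans h1 (Nat.gcd_dvd_left _ _)

/-- A modulus `q` with `2^m ≡ 1 (mod q)`, `m ∣ 720`, `gcd(q, 2^{16} − 1) = 1` is coprime to every `2^{2^n} − 1`
("`(p_i, 2^{2^n} − 1) = 1` for any `p_i` and `n`", p. 105; the printed reason is that the order `m_i = 2^{β} k'`,
`k' > 1` odd, does not divide `2^n`). [cite: Crocker1971, p. 105 and p. 107] -/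
theorem coprime_two_pow_two_pow_sub_one {q m : ℕ} (hq : 2 ^ m % q = 1) (h1 : 1 < q) (hg : Nat.gcd q 65535 = 1)
    (hm : m ∣ 720) (n : ℕ) : Nat.Coprime q (2 ^ (2 ^ n) - 1) := by
  have hqd : q ∣ 2 ^ m - 1 := by
    have : 1 % q = 2 ^ m % q := by rw [hq, Nat.mod_eq_of_lt h1]
    exact (Nat.modEq_iff_dvd' (Nat.one_le_two_pow)).mp this
  unfold Nat.Coprime
  have hg1 : Nat.gcd q (2 ^ (2 ^ n) - 1) ∣ 2 ^ Nat.gcd m (2 ^ n) - 1 := by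
    rw [← Nat.pow_sub_one_gcd_pow_sub_one]
    exact Nat.dvd_gcd (dvd_trans (Nat.gcd_dvd_left _ _) hqd) (Nat.gcd_dvd_right _ _)
  have hg2 : 2 ^ Nat.gcd m (2 ^ n) - 1 ∣ 2 ^ 16 - 1 := by
    have e : Nat.gcd (2 ^ Nat.gcd m (2 ^ n) - 1) (2 ^ 16 - 1) = 2 ^ Nat.gcd m (2 ^ n) - 1 := by
      rw [Nat.pow_sub_one_gcd_pow_sub_one, Nat.gcd_eq_left (gcd_two_pow_dvd_sixteen hm n)]
    rw [← e]
    exact Nat.gcd_dvd_right _ _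
  have hg3 : Nat.gcd q (2 ^ (2 ^ n) - 1) ∣ Nat.gcd q 65535 :=
    Nat.dvd_gcd (Nat.gcd_dvd_left _ _) (by norm_num at hg2; exact dvd_trans hg1 hg2)
  rw [hg] at hg3
  exact Nat.dvd_one.mp hg3

/-- `D` is coprime to every `2^{2^n} − 1`. [cite: Crocker1971, p. 105 and p. 107] -/
theorem crockerD_coprime (n : ℕ) (hn : 2 ≤ n) : Nat.Coprime crockerD (2 ^ (2 ^ n) - 1) := by
  unfold crockerD
  rw [Nat.coprime_list_prod_left_iff]
  intro x hx
  rcases List.mem_cons.mp hx with rfl | hx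
  · -- `16`: `2^{2^n} − 1 ≡ 15 (mod 16)`
    have h4 : 4 ≤ 2 ^ n := by
      calc (4 : ℕ) = 2 ^ 2 := by norm_num
        _ ≤ 2 ^ n := Nat.pow_le_pow_right (by norm_num) hn
    have h16 : (2 ^ (2 ^ n) - 1) % 16 = 15 := by
      obtain ⟨c, hc⟩ := Nat.exists_eq_add_of_le h4
      rw [hc, pow_add, show (2 : ℕ) ^ 4 = 16 by norm_num]
      have : 0 < 2 ^ c := Nat.two_pow_pos c
      omega
    unfold Nat.Coprime
    rw [Nat.gcd_rec, h16]
    decide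
  rcases List.mem_cons.mp hx with rfl | hx
  · -- `8191 = 2^13 − 1`
    unfold Nat.Coprime
    have h13 : Nat.gcd 13 (2 ^ n) = 1 :=
      Nat.Coprime.gcd_eq_one (Nat.Coprime.pow_right n (by norm_num : Nat.Coprime 13 2))
    have e : Nat.gcd (2 ^ 13 - 1) (2 ^ (2 ^ n) - 1) = 1 := by
      rw [Nat.pow_sub_one_gcd_pow_sub_one, h13]
      norm_num
    norm_num at e
    exact e
  · obtain ⟨t, ht, rfl⟩ := List.mem_map.mp hx
    obtain ⟨h1, h2, h3, h4, -, -, -⟩ := crockerData_facts t ht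
    exact coprime_two_pow_two_pow_sub_one h1 h2 h3 h4 n

/-- `P_n = (2^{2^n} − 1)/G_10 = 45592577 · ∏_{i<n, i≠10} F_i`. [cite: Crocker1971, (3) p. 105] -/
def crockerP (n : ℕ) : ℕ := 45592577 * ∏ i ∈ (range n).erase 10, fermatNumber i

/-- The factors `B_i` of Lemma II for the proof of Theorem I: `B_i = F_i` (`i ≠ 10`), `B_10 = F_10/G_10`.
[cite: Crocker1971, p. 106] -/
def crockerB (i : ℕ) : ℕ := if i = 10 then 45592577 else fermatNumber i

/-- `1 < B_i ∣ F_i`. [cite: Crocker1971, p. 106 ("the B_i satisfy the conditions required of them")] -/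
theorem crockerB_spec (i : ℕ) : crockerB i ∣ fermatNumber i ∧ 1 < crockerB i := by
  unfold crockerB
  split_ifs with h
  · subst h
    exact ⟨crockerD_size.1, by norm_num⟩
  · exact ⟨dvd_rfl, by have := three_le_fermatNumber i; omega⟩

/-- `P_n = ∏_{i<n} B_i`. [cite: Crocker1971, p. 106 ("∏ B_i = 2^{2^n} − 1/G_k")] -/
theorem crockerP_eq_prod {n : ℕ} (hn : 11 ≤ n) : crockerP n = ∏ i ∈ range n, crockerB i := by
  unfold crockerP
  rw [← mul_prod_erase (range n) crockerB (mem_range.mpr (by omega) : 10 ∈ range n)]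
  congr 1
  exact prod_congr rfl fun i hi => by
    rw [mem_erase] at hi
    unfold crockerB
    rw [if_neg hi.1]

/-- `P_n · G_10 = 2^{2^n} − 1` (`n ≥ 11`). [cite: Crocker1971, p. 106 ("∏ B_i = 2^{2^n} − 1/G_k")] -/
theorem crockerP_mul {n : ℕ} (hn : 11 ≤ n) :
    crockerP n * ((2 ^ (2 ^ 10) + 1) / 45592577) = 2 ^ (2 ^ n) - 1 := by
  unfold crockerP
  have e1 : 45592577 * ((2 ^ (2 ^ 10) + 1) / 45592577) = fermatNumber 10 := by
    rw [Nat.mul_div_cancel' crockerD_size.1]; rfl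
  calc 45592577 * (∏ i ∈ (range n).erase 10, fermatNumber i) * ((2 ^ (2 ^ 10) + 1) / 45592577)
      = (45592577 * ((2 ^ (2 ^ 10) + 1) / 45592577)) * ∏ i ∈ (range n).erase 10, fermatNumber i := by ring
    _ = fermatNumber 10 * ∏ i ∈ (range n).erase 10, fermatNumber i := by rw [e1]
    _ = ∏ i ∈ range n, fermatNumber i := mul_prod_erase _ _ (mem_range.mpr (by omega))
    _ = 2 ^ (2 ^ n) - 1 := by rw [prod_fermatNumber]; unfold fermatNumber; omega

/-- `P_n > 0`. [cite: Crocker1971, (3) p. 105] -/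
theorem crockerP_pos (n : ℕ) : 0 < crockerP n := by
  unfold crockerP
  exact Nat.mul_pos (by norm_num) (prod_pos fun i _ => by have := three_le_fermatNumber i; omega)

/-- `D` and `P_n` are coprime (all moduli of `S_n` distinct, p. 104/107). [cite: Crocker1971, p. 107] -/
theorem crockerD_coprime_P {n : ℕ} (hn : 11 ≤ n) : Nat.Coprime crockerD (crockerP n) :=
  Nat.Coprime.coprime_dvd_right ⟨_, (crockerP_mul hn).symm⟩ (crockerD_coprime n (by omega))

/-- The integers of Theorem I: for `n ≥ 11`, `t_n` is the least solution of `S_n`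
(`t ≡ R (mod D)`, `t ≡ 0 (mod P_n)`). [cite: Crocker1971, p. 105 ("t ≡ q_n (mod 16 (2^{2^n} − 1)/G_k ∏ p_i)")] -/
def crockerT (n : ℕ) : ℕ :=
  if hn : 11 ≤ n then (Nat.chineseRemainder (crockerD_coprime_P hn) crockerR 0 : ℕ) else 0

/-- `t_n ≡ R (mod D)`, `P_n ∣ t_n`, `t_n < D·P_n` (Chinese remainder theorem). [cite: Crocker1971, p. 105
("by the Chinese Remainder Theorem, S_n is satisfied by any integer t (and only those) such that …")] -/
theorem crockerT_spec {n : ℕ} (hn : 11 ≤ n) :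
    crockerT n % crockerD = crockerR ∧ crockerP n ∣ crockerT n ∧ crockerT n < crockerD * crockerP n := by
  have e : crockerT n = (Nat.chineseRemainder (crockerD_coprime_P hn) crockerR 0 : ℕ) := by
    unfold crockerT; rw [dif_pos hn]
  have h := (Nat.chineseRemainder (crockerD_coprime_P hn) crockerR 0).2
  rw [e]
  refine ⟨?_, ?_, ?_⟩
  · have h1 : (Nat.chineseRemainder (crockerD_coprime_P hn) crockerR 0 : ℕ) % crockerD =
        crockerR % crockerD := h.1
    rwa [Nat.mod_eq_of_lt crockerR_mod.2.2] at h1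
  · have h2 : (Nat.chineseRemainder (crockerD_coprime_P hn) crockerR 0 : ℕ) % crockerP n =
        0 % crockerP n := h.2
    rw [Nat.zero_mod] at h2
    exact Nat.dvd_of_mod_eq_zero h2
  · exact Nat.chineseRemainder_lt_mul _ _ _ crockerD_pos.ne' (crockerP_pos n).ne'

/-- `0 < t_n ≤ 2^{2^n} − 1`, `t_n ≡ −1 (mod 16)`. [cite: Crocker1971, (3) p. 105] -/
theorem crockerT_bounds {n : ℕ} (hn : 11 ≤ n) :
    crockerT n % 16 = 15 ∧ 0 < crockerT n ∧ crockerT n ≤ 2 ^ (2 ^ n) - 1 := by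
  obtain ⟨hR, -, hlt⟩ := crockerT_spec hn
  have h16 : crockerT n % 16 = 15 := by
    have hd : 16 ∣ crockerD := by unfold crockerD; exact List.dvd_prod List.mem_cons_self
    rw [← Nat.mod_mod_of_dvd _ hd, hR, crockerR_mod.1]
  refine ⟨h16, by omega, ?_⟩
  have hle : crockerD * crockerP n ≤ 2 ^ (2 ^ n) - 1 := by
    rw [← crockerP_mul hn, mul_comm]
    apply Nat.mul_le_mul_left
    exact Nat.le_div_iff_mul_le (by norm_num) |>.mpr crockerD_size.2
  omega

/-- `t_n ≡ 2^{a_i} (mod q_i)` and `t_n ≡ 0 (mod 8191)`. [cite: Crocker1971, (2) p. 103] -/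
theorem crockerT_residues {n : ℕ} (hn : 11 ≤ n) :
    crockerT n % 8191 = 0 ∧ ∀ t ∈ crockerData, crockerT n % t.2.2 = 2 ^ t.1 % t.2.2 := by
  obtain ⟨hR, -, -⟩ := crockerT_spec hn
  constructor
  · have hd : 8191 ∣ crockerD := by
      unfold crockerD; exact List.dvd_prod (List.mem_cons_of_mem _ List.mem_cons_self)
    rw [← Nat.mod_mod_of_dvd _ hd, hR, crockerR_mod.2.1]
  · intro t ht
    have hd : t.2.2 ∣ crockerD := by
      unfold crockerD
      exact List.dvd_prod (List.mem_cons_of_mem _ (List.mem_cons_of_mem _ (List.mem_map.mpr ⟨t, ht, rfl⟩)))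
    rw [← Nat.mod_mod_of_dvd _ hd, hR]
    exact (crockerData_facts t ht).2.2.2.2.2.1

/-- **`t_n` is not a prime plus a power of two** (systems (1)–(2): `q_i ∣ t_n − 2^k` for the congruence of (1)
containing `k`, so the prime would be `q_i`, and then `t_n ≡ q_i + 2^{k mod 13} (mod 2^{13} − 1)`, excluded by
the choice of `c`). [cite: Crocker1971, pp. 103–104 and p. 107] -/
theorem crockerT_ne_prime_add_two_pow {n : ℕ} (hn : 11 ≤ n) {p : ℕ} (hp : p.Prime) (k : ℕ) :
    crockerT n ≠ p + 2 ^ k := by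
  intro h
  obtain ⟨t, ht, hk⟩ := crockerData_covers k
  obtain ⟨hm1, hq1, -, -, -, -, hc⟩ := crockerData_facts t ht
  obtain ⟨h8191, hres⟩ := crockerT_residues hn
  have hres := hres t ht
  -- `2^k ≡ 2^{a_i} (mod q_i)`
  have h2k : 2 ^ k % t.2.2 = 2 ^ t.1 % t.2.2 := by
    rw [← Nat.div_add_mod k t.2.1, hk, pow_add, pow_mul, Nat.mul_mod, Nat.pow_mod, hm1, one_pow,
      Nat.one_mod_eq_one.mpr hq1.ne', one_mul, Nat.mod_mod]
  -- hence `q_i ∣ p`, so `p = q_i`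
  have hpq : p % t.2.2 = 0 := by
    rw [h, Nat.add_mod, h2k] at hres
    have h1 : p % t.2.2 < t.2.2 := Nat.mod_lt _ (by omega)
    have h2 : 2 ^ t.1 % t.2.2 < t.2.2 := Nat.mod_lt _ (by omega)
    -- (u + v) % q = v with u, v < q forces u = 0
    have key : ∀ u v q : ℕ, u < q → v < q → (u + v) % q = v → u = 0 := by
      intro u v q hu hv huv
      rcases Nat.lt_or_ge (u + v) q with hlt | hge
      · rw [Nat.mod_eq_of_lt hlt] at huv; omega
      · rw [Nat.mod_eq_sub_mod, Nat.mod_eq_of_lt (by omega)] at huv <;> omega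
    exact key _ _ _ h1 h2 hres
  have hpeq : p = t.2.2 := by
    rcases (Nat.dvd_prime hp).mp (Nat.dvd_of_mod_eq_zero hpq) with h1 | h1
    · omega
    · exact h1.symm
  -- then `t_n = q_i + 2^k ≡ q_i + 2^{k mod 13} (mod 8191)`, contradicting the choice `c = 0`
  have h13 : 2 ^ k % 8191 = 2 ^ (k % 13) % 8191 := by
    conv_lhs => rw [← Nat.div_add_mod k 13, pow_add, pow_mul]
    rw [Nat.mul_mod, Nat.pow_mod]
    norm_num
  have : (t.2.2 + 2 ^ (k % 13)) % 8191 = 0 := by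
    rw [h, hpeq, Nat.add_mod, h13, ← Nat.add_mod] at h8191
    exact h8191
  exact hc (k % 13) (Nat.mod_lt k (by norm_num)) this

/-- **`t_n` is not a prime plus two distinct positive powers of two** (Lemma II with `B_i = F_i`, `B_10 = F_10/G_10`,
`w = t_n / P_n ≡ 1 (mod 16)`). [cite: Crocker1971, p. 106] -/
theorem crockerT_ne_prime_add_two_distinct_pow {n : ℕ} (hn : 11 ≤ n) {p a b : ℕ} (hp : p.Prime) (ha : 0 < a)
    (hb : 0 < b) (hab : a ≠ b) : crockerT n ≠ p + 2 ^ a + 2 ^ b := by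
  obtain ⟨-, hP, -⟩ := crockerT_spec hn
  obtain ⟨h16, hpos, hle⟩ := crockerT_bounds hn
  obtain ⟨w, hw⟩ := hP
  have hBn : ∀ i < n, crockerB i ∣ fermatNumber i ∧ 1 < crockerB i := fun i _ => crockerB_spec i
  have hPB := crockerP_eq_prod hn
  -- `w ≡ 1 (mod 16)` from `t ≡ 15`, `P_n ≡ 15 (mod 16)`
  have hP16 : crockerP n % 16 = 15 := by rw [hPB]; exact prod_mod_sixteen (by omega) crockerB hBn
  have hw16 : w % 16 = 1 := by
    rw [hw, Nat.mul_mod, hP16] at h16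
    have : w % 16 < 16 := Nat.mod_lt _ (by norm_num)
    interval_cases (w % 16) <;> omega
  have e : crockerT n = w * ∏ i ∈ range n, crockerB i := by rw [← hPB, hw, mul_comm]
  rw [e] at hle ⊢
  exact crocker1971_lemma2 (by omega) hw16 crockerB hBn hle hp ha hb hab

/-- `t_n < t_{n+1}` (`t_{n+1}` is a positive multiple of `F_n = 2^{2^n} + 1 > t_n`). [cite: Crocker1971, p. 106] -/
theorem crockerT_lt_succ {n : ℕ} (hn : 11 ≤ n) : crockerT n < crockerT (n + 1) := by
  obtain ⟨-, -, hle⟩ := crockerT_bounds hn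
  obtain ⟨-, hP, -⟩ := crockerT_spec (show 11 ≤ n + 1 by omega)
  obtain ⟨-, hpos, -⟩ := crockerT_bounds (show 11 ≤ n + 1 by omega)
  have hF : fermatNumber n ∣ crockerP (n + 1) := by
    unfold crockerP
    exact dvd_mul_of_dvd_right (dvd_prod_of_mem _ (mem_erase.mpr ⟨by omega, mem_range.mpr (by omega)⟩)) _
  have h1 : fermatNumber n ≤ crockerT (n + 1) := Nat.le_of_dvd hpos (dvd_trans hF hP)
  unfold fermatNumber at h1
  have : 0 < 2 ^ (2 ^ n) := Nat.two_pow_pos _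
  omega

/-- The `t_n` increase strictly. [cite: Crocker1971, p. 106 ("the integers … for n are less than those obtained
for the successive integer n + 1")] -/
theorem crockerT_strictMono : StrictMono fun j : ℕ => crockerT (j + 11) := by
  refine strictMono_nat_of_lt_succ fun j => ?_
  exact crockerT_lt_succ (by omega)

/-- **Crocker's Theorem I** [Crocker1971, p. 103]: "There is an infinity of distinct, positive odd integers not
representable as the sum of a prime and of two positive powers of 2."  (The integers `t_n`, `n ≥ 11`: two equal
powers `2^a + 2^a = 2^{a+1}` are excluded by `crockerT_ne_prime_add_two_pow`, two distinct ones by Lemma II.)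
[cite: Crocker1971, Theorem I, p. 103; proof pp. 103–107] -/
theorem crocker1971_theorem1 :
    Set.Infinite {t : ℕ | t % 2 = 1 ∧ ∀ p a b : ℕ, p.Prime → 0 < a → 0 < b → t ≠ p + 2 ^ a + 2 ^ b} := by
  have hmem : ∀ j : ℕ, crockerT (j + 11) ∈
      {t : ℕ | t % 2 = 1 ∧ ∀ p a b : ℕ, p.Prime → 0 < a → 0 < b → t ≠ p + 2 ^ a + 2 ^ b} := by
    intro j
    have hn : 11 ≤ j + 11 := by omega
    obtain ⟨h16, -, -⟩ := crockerT_bounds hn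
    refine ⟨by omega, fun p a b hp ha hb => ?_⟩
    rcases eq_or_ne a b with rfl | hab
    · -- `2^a + 2^a = 2^{a+1}`
      intro h
      have e : p + 2 ^ a + 2 ^ a = p + 2 ^ (a + 1) := by ring
      exact crockerT_ne_prime_add_two_pow hn hp (a + 1) (h.trans e)
    · exact crockerT_ne_prime_add_two_distinct_pow hn hp ha hb hab
  exact Set.infinite_of_injective_forall_mem crockerT_strictMono.injective hmem

/-- The same integers are not `p + 2^k` either (p. 103: "an infinity of positive odd integers not the sum of a
prime and a positive power of 2 nor the sum of a prime and of two distinct positive powers of 2").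
[cite: Crocker1971, p. 103] -/
theorem crocker1971_theorem1' :
    Set.Infinite {t : ℕ | t % 2 = 1 ∧ (∀ p k : ℕ, p.Prime → t ≠ p + 2 ^ k) ∧
      ∀ p a b : ℕ, p.Prime → 0 < a → 0 < b → t ≠ p + 2 ^ a + 2 ^ b} := by
  have hmem : ∀ j : ℕ, crockerT (j + 11) ∈
      {t : ℕ | t % 2 = 1 ∧ (∀ p k : ℕ, p.Prime → t ≠ p + 2 ^ k) ∧
        ∀ p a b : ℕ, p.Prime → 0 < a → 0 < b → t ≠ p + 2 ^ a + 2 ^ b} := by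
    intro j
    have hn : 11 ≤ j + 11 := by omega
    obtain ⟨h16, -, -⟩ := crockerT_bounds hn
    refine ⟨by omega, fun p k hp => crockerT_ne_prime_add_two_pow hn hp k, fun p a b hp ha hb => ?_⟩
    rcases eq_or_ne a b with rfl | hab
    · intro h
      have e : p + 2 ^ a + 2 ^ a = p + 2 ^ (a + 1) := by ring
      exact crockerT_ne_prime_add_two_pow hn hp (a + 1) (h.trans e)
    · exact crockerT_ne_prime_add_two_distinct_pow hn hp ha hb hab
  exact Set.infinite_of_injective_forall_mem crockerT_strictMono.injective hmem

end Crocker1971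

end Literature.NumberTheory.Sieve
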